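import Mathlib.Computability.Partrec
import Mathlib.Algebra.Polynomial.Eval.Defs
import Mathlib.Data.ENat.Lattice
import Mathlib.Data.Set.Finite.List
import Literature.Computability.Complexity.TimeBounds
import Literature.Computability.Complexity.BoolEncodings
import Literature.Computability.Complexity.Classes
import Literature.Computability.Complexity.Nondeterministic
import Literature.Computability.MetaComplexity.Kolmogorov
import Literature.Computability.MetaComplexity.UniversalMachine
import HarnessLib

-- provenance: harness21/H21/H21/Statements/CryptoFoundations/Kolmogorov.lean @ 1293438 (interim HEAD d8f2665); M5 mechanical rewrite
/-!
# Crypto foundations: Kolmogorov-complexity statements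

Family `CryptoFoundations` (trunk `CplxMeta`, outline §3), statements
**crypto-foundations.S10** and **crypto-foundations.S11**.

* **S10** (definition role; Liu–Pass FOCS 2020, §2.2): the time-bounded Kolmogorov complexity
  `K^t(x) = min {|Π| : U(Π, 1^{t(|x|)}) outputs x within t(|x|) steps}` for a polynomial time
  bound `t` and a fixed universal machine `U` with polynomial overhead. The prelude
  (`Literature.Prelude.CplxMeta.UniversalMachine`) provides the `ℕ∞`-valued `U.kt`; here we package
  Liu–Pass's `ℕ`-valued `K^t` for polynomial `t` as `liuPassKt U t x`, characterise it as the
  `sInf` of the set of lengths of printing programs (`liuPassKt_eq_sInf`), and record the basic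
  bound `K^t(x) ≤ |x| + c` for `t(n) ≥ (1+ε)n` (`liuPassKt_le_length_add`).
* **S11** (known theorems; Li–Vitányi 3rd ed., Thm 2.1.1 and Thm 2.3.2): the two-sided
  invariance theorem `|C_U(x) − C_V(x)| ≤ c` for additively optimal `U, V`, existence of an
  additively optimal method, and uncomputability of plain Kolmogorov complexity `C`.
* Non-bold sanity lemma `MKtimeP_mem_NP`: `MK^tP[s] ∈ NP` for polynomial `t, s`
  (Liu–Pass 2020, §2.2: guess the program, run the efficient universal machine).

## Mathlib search

Mathlib has no Kolmogorov complexity (`rg -i kolmogorov` only hits probability theory) and no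
universal clocked machine; we reuse Mathlib's `Computable`, `Partrec`, `PFun`, `Polynomial.eval`,
`ENat.toNat`, `ENat.iInf_toNat`, and the accepted H21 preludes `Literature.Computability.MetaComplexity.descComplexity`,
`IsAdditivelyOptimal`, `univDescription`, `kolmogorovComplexity`, `UniversalMachine.kt/ktAt`,
`UniversalMachine.MKtimeP`, `Literature.Computability.Complexity.Nondeterministic.NP`.

## Design notes

* `liuPassKt` projects `U.kt` to `ℕ` with `ENat.toNat`; the junk value `⊤ ↦ 0` is taken iff no
  program prints `x` within `t(|x|)` steps, matching the `sInf ∅ = 0` convention on the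
  right-hand side of `liuPassKt_eq_sInf`. Under Liu–Pass's standing convention
  `t(n) ≥ (1+ε)n` this happens for at most finitely many lengths (`kt_lt_top_of_le`).
* The invariance theorem has a real (short) proof from the prelude; `exists_isAdditivelyOptimal`,
  `not_computable_kolmogorovComplexity` and `MKtimeP_mem_NP` are named facts (D-0014). The
  general uncomputability statement `IsAdditivelyOptimal.not_exists_computable` (LV Thm 2.3.2)
  is discharged at the end of the file (`IsAdditivelyOptimal.not_exists_computable_holds`), and
  `not_computable_kolmogorovComplexity` is reduced to `isAdditivelyOptimal_univDescription`.

## References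

* Y. Liu, R. Pass, *On one-way functions and Kolmogorov complexity*, FOCS 2020, §2.2.
* M. Li, P. Vitányi, *An Introduction to Kolmogorov Complexity and Its Applications*, 3rd ed.,
  Springer 2008, Thm 2.1.1 (invariance), Thm 2.1.2, Thm 2.3.2 (`C` is not computable).
* M. Li, P. Vitányi, *Kolmogorov complexity and its applications*, in: Handbook of Theoretical
  Computer Science vol. A, Elsevier 1990, §2.5, Theorem (Kolmogorov) (a), p. 207 (same
  statement and proof as Thm 2.3.2 of the book).
-/

namespace Literature.Computability.Cryptography

open _root_.Computability Complexity Complexity.Nondeterministic MetaComplexity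

/-! ### S10: Liu–Pass time-bounded Kolmogorov complexity -/

section S10

variable (U : UniversalMachine) (t : Polynomial ℕ) (x : List Bool)

/-- **crypto-foundations.S10** (definition; Liu–Pass FOCS 2020, §2.2). Liu–Pass's time-bounded
Kolmogorov complexity `K^t(x) = min {|Π| : U(Π, 1^{t(|x|)}) outputs x within t(|x|) steps}` for
a polynomial time bound `t` and an efficient universal machine `U` (with polynomial simulation
overhead, `UniversalMachine.sim`), as a natural number: the `ENat.toNat` projection of the
prelude's `U.kt (fun n => t.eval n) x`. Junk value: `0` iff no program prints `x` within
`t(|x|)` steps (see `liuPassKt_eq_sInf`, `liuPassKt_eq_zero_of_forall`). [cite: FOCS2020, §2.2] -/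
noncomputable def liuPassKt : ℕ :=
  (U.kt (fun n => t.eval n) x).toNat

/-- `liuPassKt` unfolds to the `toNat` of `K^{t(|x|)}(x)` at the absolute budget `t(|x|)`.
[Liu–Pass 2020, §2.2] [cite: LiuPass2020, §2.2] -/
theorem liuPassKt_def : liuPassKt U t x = (U.ktAt (t.eval x.length) x).toNat :=
  rfl

/-- **crypto-foundations.S10** (characterisation; Liu–Pass FOCS 2020, §2.2). `K^t(x)` is
literally `min {|Π| : U(Π, 1^{t(|x|)}) = x}`: the infimum in `ℕ` of the set of lengths of
programs printing `x` within `t(|x|)` steps. Both sides take the junk value `0` (`⊤.toNat`,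
resp. `sInf ∅`) iff no such program exists. [cite: FOCS2020, §2.2] -/
theorem liuPassKt_eq_sInf : liuPassKt U t x =
    sInf {n : ℕ | ∃ prog : List Bool, prog.length = n ∧ U.run prog (t.eval x.length) = some x} := by
  rw [liuPassKt_def, UniversalMachine.ktAt, iInf_subtype', ENat.iInf_toNat, iInf]
  congr 1
  ext n
  simp only [Set.mem_range, Subtype.exists, exists_prop, Set.mem_setOf_eq]
  exact exists_congr fun _ => and_comm

/-- If no program prints `x` within `t(|x|)` steps then `liuPassKt U t x = 0` (the documented
junk value). [Liu–Pass 2020, §2.2] [cite: LiuPass2020, §2.2] -/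
theorem liuPassKt_eq_zero_of_forall
    (h : ∀ prog : List Bool, U.run prog (t.eval x.length) ≠ some x) : liuPassKt U t x = 0 := by
  rw [liuPassKt_def, (U.ktAt_eq_top_iff).2 h, ENat.toNat_top]

/-- Any program printing `x` within `t(|x|)` steps bounds `K^t(x)`. [Liu–Pass 2020, §2.2] [cite: LiuPass2020, §2.2] -/
theorem liuPassKt_le_length {U t x} {prog : List Bool}
    (h : U.run prog (t.eval x.length) = some x) : liuPassKt U t x ≤ prog.length :=
  ENat.toNat_le_of_le_coe (U.ktAt_le_length h)

/-- **crypto-foundations.S10** (basic bound; Liu–Pass FOCS 2020, §2.2, Fact 2.2). Under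
Liu–Pass's standing convention `t(n) ≥ (1+ε)n` on the polynomial time bound, there is a
constant `c` with `K^t(x) ≤ |x| + c` for all sufficiently long `x`. Real proof from the
prelude's `UniversalMachine.kt_le_length_add`. [cite: FOCS2020, §2.2  Fact 2.2] -/
theorem liuPassKt_le_length_add {ε : ℝ} (hε : 0 < ε)
    (ht : ∀ n : ℕ, (1 + ε) * n ≤ ((t.eval n : ℕ) : ℝ)) :
    ∃ c n₀ : ℕ, ∀ x : List Bool, n₀ ≤ x.length → liuPassKt U t x ≤ x.length + c := by
  obtain ⟨c, n₀, h⟩ := U.kt_le_length_add hε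
  refine ⟨c, n₀, fun x hx => ENat.toNat_le_of_le_coe ?_⟩
  exact_mod_cast h x hx (t.eval x.length) (Nat.ceil_le.2 (ht x.length))

end S10

/-! ### S11: invariance theorem and uncomputability of plain `C` -/

section S11

/-- **crypto-foundations.S11** (invariance theorem; Li–Vitányi 3rd ed., Thm 2.1.1). For any two
additively optimal (universal) description methods `U, V` there is a constant `c` with
`|C_U(x) − C_V(x)| ≤ c` for all `x`, stated as the two one-sided inequalities in `ℕ∞`. Real
proof from the definition of `IsAdditivelyOptimal`. [folklore] -/
theorem invariance_theorem {U V : List Bool →. List Bool} (hU : IsAdditivelyOptimal U)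
    (hV : IsAdditivelyOptimal V) : ∃ c : ℕ, ∀ x : List Bool,
      descComplexity U x ≤ descComplexity V x + c ∧
        descComplexity V x ≤ descComplexity U x + c := by
  obtain ⟨c₁, h₁⟩ := hU.2 V hV.1
  obtain ⟨c₂, h₂⟩ := hV.2 U hU.1
  refine ⟨max c₁ c₂, fun x => ⟨(h₁ x).trans ?_, (h₂ x).trans ?_⟩⟩
  · exact add_le_add_right (by exact_mod_cast le_max_left c₁ c₂) _
  · exact add_le_add_right (by exact_mod_cast le_max_right c₁ c₂) _

/-- **crypto-foundations.S11** (existence half of the invariance theorem; Li–Vitányi 3rd ed.,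
Thm 2.1.1). There exists an additively optimal partial recursive description method (namely
the prelude's reference method `univDescription`). [folklore] -/
def exists_isAdditivelyOptimal : Prop :=
  ∃ U : List Bool →. List Bool, IsAdditivelyOptimal U

/- interim proof relied on results that are now named facts (D-0014); demoted to a fact by the M5 import, proof preserved:
:=
  ⟨univDescription, isAdditivelyOptimal_univDescription⟩
-/

/-- **crypto-foundations.S11** (Li–Vitányi 3rd ed., Thm 2.3.2). Plain Kolmogorov complexity
`C : {0,1}* → ℕ` is not a computable function. (`kolmogorovComplexity` never takes the
`ENat.toNat` junk value, by `descComplexity_univDescription_lt_top`.) [cite: LiVitanyi3rd2008, Thm. 2.3.2] -/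
def not_computable_kolmogorovComplexity : Prop :=
  ¬ Computable kolmogorovComplexity

/-- **crypto-foundations.S11** (Li–Vitányi 3rd ed., Thm 2.3.2, general form). For every
additively optimal description method `U`, the complexity `C_U` is not (the coercion of) any
computable total function `{0,1}* → ℕ`. [cite: LiVitanyi3rd2008, Thm. 2.3.2] -/
def _root_.Literature.Computability.MetaComplexity.IsAdditivelyOptimal.not_exists_computable : Prop :=
  ∀ {U : List Bool →. List Bool} (hU : IsAdditivelyOptimal U),
    ¬ ∃ f : List Bool → ℕ, Computable f ∧ ∀ x : List Bool, descComplexity U x = f x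

end S11

/-! ### Sanity: `MK^tP[s] ∈ NP` -/

/-- Sanity lemma: for polynomial time bound `t` and threshold `s`, Liu–Pass's language
`MK^tP[s] = {x | K^t(x) ≤ s(|x|)}` is in `NP` — guess a program of length `≤ s(|x|)` and run
the (polynomial-time, `UniversalMachine.polyTime`) universal machine for `t(|x|)` steps.
[Liu–Pass 2020, §2.2; Ko 1991] [cite: LiuPass2020, §2.2] -/
def MKtimeP_mem_NP : Prop :=
  ∀ (U : UniversalMachine) (p q : Polynomial ℕ),
    U.MKtimeP (fun n => p.eval n) (fun n => q.eval n) ∈ NP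

end Literature.Computability.Cryptography

/-! ### S11: proof of the uncomputability of `C_U` (Li–Vitányi 3rd ed., Thm 2.3.2) -/

namespace Literature.Computability.Cryptography

open _root_.Computability Complexity Complexity.Nondeterministic MetaComplexity

/-- Only finitely many strings have `φ`-complexity `< m`: each is the (unique) output of one
of the finitely many programs of length `< m`. [cite: LiVitanyi3rd2008, Thm. 2.2.1] -/
theorem finite_setOf_descComplexity_lt (φ : List Bool →. List Bool) (m : ℕ) :
    {x | descComplexity φ x < m}.Finite := by
  refine ((List.finite_length_lt Bool m).biUnion fun p _ =>
    (show ({x | x ∈ φ p} : Set (List Bool)).Subsingleton from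
      fun x hx y hy => Part.mem_unique hx hy).finite).subset ?_
  intro x hx
  obtain ⟨p, hp, hpm⟩ := exists_length_lt_of_descComplexity_lt hx
  exact Set.mem_biUnion (t := fun p => {x | x ∈ φ p}) hpm hp

/-- **crypto-foundations.S11**, discharged (Li–Vitányi 3rd ed., Thm 2.3.2, first assertion:
"The function `C(x)` is not computable"; the same statement and proof appear as Theorem
(Kolmogorov) (a) in Li–Vitányi, *Kolmogorov complexity and its applications*, Handbook of
TCS vol. A (1990), §2.5, p. 207). The printed proof: if `C_U` were a computable `f`, the method
`ψ(p) := ` "the first string `x` (along a computable injective enumeration) with `f x > 2|p|`"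
is partial recursive and total (by counting, `finite_setOf_descComplexity_lt`, arbitrarily
complex strings exist), so `C_ψ(ψ p) ≤ |p|`; additive optimality gives
`2|p| < f (ψ p) = C_U(ψ p) ≤ |p| + c_ψ`, false for `|p| = c_ψ`. (The book searches for the least
`x` with `C(x) ≥ m` from input `m`, giving `m ≤ log m + O(1)`; we feed the threshold in unary as
`|p|` and double it instead, which avoids binary length bookkeeping.)
[cite: LiVitanyi3rd2008, Thm. 2.3.2] -/
theorem _root_.Literature.Computability.MetaComplexity.IsAdditivelyOptimal.not_exists_computable_holds :
    IsAdditivelyOptimal.not_exists_computable := by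
  intro U hU ⟨f, hf, hUf⟩
  -- a computable injective enumeration of strings: `g n = 1ⁿ`
  let g : ℕ → List Bool := fun n => (List.range n).map fun _ => true
  have hg_len : ∀ n, (g n).length = n := fun n => by simp [g]
  have hg : Computable g := (Primrec.list_range.list_map (Primrec₂.const true)).to_comp
  -- arbitrarily complex strings exist along `g` (counting argument)
  have hex : ∀ k : ℕ, ∃ n, k < f (g n) := by
    intro k
    by_contra h
    push Not at h
    have hsub : Set.range g ⊆ {x | descComplexity U x < (k + 1 : ℕ)} := by
      rintro _ ⟨n, rfl⟩
      show descComplexity U (g n) < ((k + 1 : ℕ) : ℕ∞)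
      rw [hUf]
      exact_mod_cast Nat.lt_succ_of_le (h n)
    have hinj : Function.Injective g := fun m n hmn => by rw [← hg_len m, ← hg_len n, hmn]
    exact Set.infinite_range_of_injective hinj
      ((finite_setOf_descComplexity_lt U (k + 1)).subset hsub)
  -- the description method `ψ p := first g n with 2 * |p| < f (g n)`
  let F : List Bool × ℕ → Option (List Bool) := fun q =>
    bif decide (2 * q.1.length < f (g q.2)) then some (g q.2) else none
  have hF : Computable F := by
    refine Computable.cond ?_ (Computable.option_some.comp (hg.comp Computable.snd))
      (Computable.const none)
    exact Primrec.nat_lt.decide.to_comp.comp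
      (Primrec.nat_mul.to_comp.comp (Computable.const 2)
        (Computable.list_length.comp Computable.fst))
      (hf.comp (hg.comp Computable.snd))
  let ψ : List Bool →. List Bool := fun p => Nat.rfindOpt fun n => F (p, n)
  have hψ : Partrec ψ := Partrec.rfindOpt hF.to₂
  -- `ψ` is total and its output on `p` has `U`-complexity `> 2 |p|`
  have hout : ∀ p : List Bool, ∃ x ∈ ψ p, 2 * p.length < f x := by
    intro p
    obtain ⟨n, hn⟩ := hex (2 * p.length)
    have hdom : (ψ p).Dom := Nat.rfindOpt_dom.2 ⟨n, g n, by simp [F, hn]⟩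
    refine ⟨(ψ p).get hdom, Part.get_mem hdom, ?_⟩
    obtain ⟨m, hm⟩ := Nat.rfindOpt_spec (Part.get_mem hdom)
    by_cases hlt : 2 * p.length < f (g m)
    · simp only [F, hlt, decide_true, cond_true, Option.mem_def, Option.some.injEq] at hm
      rw [← hm]
      exact hlt
    · simp [F, hlt] at hm
  -- additive optimality of `U` against `ψ`, at the program `p = 1ᶜ`
  obtain ⟨c, hc⟩ := hU.2 ψ hψ
  obtain ⟨x, hx, hlt⟩ := hout (List.replicate c true)
  have h1 : descComplexity U x ≤ ((List.replicate c true).length : ℕ∞) + c := by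
    refine (hc x).trans ?_
    gcongr
    exact descComplexity_le_length hx
  rw [hUf, List.length_replicate] at h1
  rw [List.length_replicate] at hlt
  have h2 : f x ≤ c + c := by exact_mod_cast h1
  omega

/-- Corollary (Li–Vitányi 3rd ed., Thm 2.3.2 for the reference method): granted the additive
optimality of `univDescription` (the named fact `isAdditivelyOptimal_univDescription`,
LV Thm 2.1.1), plain Kolmogorov complexity `C = kolmogorovComplexity` is not computable, i.e.
the named fact `not_computable_kolmogorovComplexity` follows. [cite: LiVitanyi3rd2008, Thm. 2.3.2] -/
theorem not_computable_kolmogorovComplexity_of_isAdditivelyOptimal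
    (h : isAdditivelyOptimal_univDescription) : not_computable_kolmogorovComplexity :=
  fun hcomp => IsAdditivelyOptimal.not_exists_computable_holds h
    ⟨kolmogorovComplexity, hcomp, fun x => (coe_kolmogorovComplexity x).symm⟩

end Literature.Computability.Cryptography
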